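import Mathlib
import HarnessLib

/-!
# Comparability of the renormalised covariances from a derivative bound:
# `|d/ds ĉ(s)| ≤ K ĉ(s) ⇒ ĉ(s) ≤ e^{K s} ĉ(0)` ([ABKM19] Lemma 7.7, (7.74)–(7.75))

In the proof of [ABKM19] Lemma 7.7 the step covariances `𝒞^{(q)}_{k+1}` and `𝒞^{(0)}_{k+1}` are
shown to be comparable, `𝒞^{(q)}_{k+1} ≤ (1+ρ)𝒞^{(0)}_{k+1}` for `q ∈ B_κ`, mode by mode in Fourier
space: the derivative of the multiplier in the coefficient matrix is bounded by a constant times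
`|𝒞̂^{(0)}(p)⁻¹|⁻¹` (the finite-range decomposition's derivative bounds divided by its LOWER shell
bounds, (7.74)), which after integration along the segment gives (7.75).  This file records the
one-dimensional real-analysis step of that argument in the form the tree's `GradientFRD.TorusFRD`
(derivative bounds at every point of the elliptic class, uniform constants) feeds it:

* **`le_exp_mul_of_abs_deriv_le`** — if `c` is differentiable on `[0, t]` with `|c'(s)| ≤ K c(s)`
  there, then `c t ≤ exp (K t) · c 0`;
* **`ge_exp_neg_mul_of_abs_deriv_le`** — and `exp (−K t) · c 0 ≤ c t`;
* `le_one_add_mul_of_abs_deriv_le` — the form used downstream: for `K t ≤ log (1+ρ)`,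
  `c t ≤ (1+ρ) · c 0` ((7.75) with `κ = κ(ρ, L)`).

Everything is proved; no named fact.  Not here: the instantiation for the torus decomposition
(`TorusFRD` clause (v): `‖∂_s 𝒞̂_{A+sB,k}(κ)‖ ≤ C₁ …` over `c … ≤ Re 𝒞̂_{A,k}(κ)` gives
`K = (C₁/c) L^{4(d+ñ)+2}`).

## References
* S. Adams, S. Buchholz, R. Kotecký, S. Müller, arXiv:1910.13564, Lemma 7.7, (7.74)–(7.75)
  [AdamsBuchholzKoteckyMuller2019].
-/

noncomputable section

namespace Literature.MathematicalPhysics.StatisticalMechanics.GradientRG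

open Real Set

/-- **Grönwall comparison, upper form**: if `c` has derivative `c'` at every point of `[0, t]`
(`t ≥ 0`) with `|c' s| ≤ K · c s`, then `c t ≤ exp (K t) · c 0` (the function `s ↦ e^{−Ks} c(s)` is
non-increasing). [cite: AdamsBuchholzKoteckyMuller2019, Lemma 7.7 (7.75)] -/
theorem le_exp_mul_of_abs_deriv_le {c c' : ℝ → ℝ} {K t : ℝ} (ht : 0 ≤ t)
    (hc : ∀ s ∈ Icc 0 t, HasDerivAt c (c' s) s) (hb : ∀ s ∈ Icc 0 t, |c' s| ≤ K * c s) :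
    c t ≤ exp (K * t) * c 0 := by
  -- `g(s) = e^{−Ks} c(s)` is antitone on `[0, t]`
  set g : ℝ → ℝ := fun s => exp (-K * s) * c s with hg
  have hg' : ∀ s ∈ Icc 0 t, HasDerivAt g (exp (-K * s) * (c' s - K * c s)) s := by
    intro s hs
    have h1 : HasDerivAt (fun s => exp (-K * s)) (exp (-K * s) * (-K)) s := by
      have := ((hasDerivAt_id s).const_mul (-K)).exp
      simpa [mul_comm] using this
    exact (h1.mul (hc s hs)).congr_deriv (by ring)
  have hcont : ContinuousOn g (Icc 0 t) := fun s hs => (hg' s hs).continuousAt.continuousWithinAt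
  have hdiff : DifferentiableOn ℝ g (interior (Icc 0 t)) := by
    rw [interior_Icc]
    intro s hs
    exact (hg' s (Ioo_subset_Icc_self hs)).differentiableAt.differentiableWithinAt
  have hnonpos : ∀ s ∈ interior (Icc 0 t), deriv g s ≤ 0 := by
    rw [interior_Icc]
    intro s hs
    rw [(hg' s (Ioo_subset_Icc_self hs)).deriv]
    have h1 : c' s - K * c s ≤ 0 := by
      have := (abs_le.1 (hb s (Ioo_subset_Icc_self hs))).2
      linarith
    exact mul_nonpos_of_nonneg_of_nonpos (exp_pos _).le h1
  have hanti : AntitoneOn g (Icc 0 t) := antitoneOn_of_deriv_nonpos (convex_Icc 0 t) hcont hdiff hnonpos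
  have h := hanti (left_mem_Icc.2 ht) (right_mem_Icc.2 ht) ht
  -- unfold `g`
  have h0 : g 0 = c 0 := by simp [hg]
  have h1 : g t = exp (-K * t) * c t := rfl
  rw [h0, h1] at h
  have hexp : 0 < exp (K * t) := exp_pos _
  calc c t = exp (K * t) * (exp (-K * t) * c t) := by
        rw [← mul_assoc, ← Real.exp_add]; simp
    _ ≤ exp (K * t) * c 0 := mul_le_mul_of_nonneg_left h hexp.le

/-- **Grönwall comparison, lower form**: under the same hypotheses `exp (−K t) · c 0 ≤ c t`
(apply the upper form to `s ↦ c(t − s)`). [cite: AdamsBuchholzKoteckyMuller2019, Lemma 7.7 (7.75)] -/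
theorem ge_exp_neg_mul_of_abs_deriv_le {c c' : ℝ → ℝ} {K t : ℝ} (ht : 0 ≤ t)
    (hc : ∀ s ∈ Icc 0 t, HasDerivAt c (c' s) s) (hb : ∀ s ∈ Icc 0 t, |c' s| ≤ K * c s) :
    exp (-K * t) * c 0 ≤ c t := by
  -- the reversed function
  set e : ℝ → ℝ := fun s => c (t - s) with he
  have hmem : ∀ s ∈ Icc 0 t, t - s ∈ Icc 0 t := fun s hs => by
    rw [mem_Icc] at hs ⊢; constructor <;> linarith
  have he' : ∀ s ∈ Icc 0 t, HasDerivAt e (-(c' (t - s))) s := by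
    intro s hs
    have h1 : HasDerivAt (fun x : ℝ => t - x) (-1) s := by
      simpa using (hasDerivAt_id s).const_sub t
    have h2 : HasDerivAt (fun x : ℝ => c (t - x)) (c' (t - s) * -1) s := (hc (t - s) (hmem s hs)).comp s h1
    exact h2.congr_deriv (by ring)
  have hb' : ∀ s ∈ Icc 0 t, |-(c' (t - s))| ≤ K * e s := fun s hs => by
    rw [abs_neg]; exact hb (t - s) (hmem s hs)
  have h := le_exp_mul_of_abs_deriv_le ht he' hb'
  have h0 : e 0 = c t := by simp [he]
  have h1 : e t = c 0 := by simp [he]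
  rw [h0, h1] at h
  have hexp : 0 < exp (-K * t) := exp_pos _
  calc exp (-K * t) * c 0 ≤ exp (-K * t) * (exp (K * t) * c t) := mul_le_mul_of_nonneg_left h hexp.le
    _ = c t := by rw [← mul_assoc, ← Real.exp_add]; simp

/-- **The `(1+ρ)`-comparison** ([ABKM19] (7.75)): under the hypotheses of the upper form and
`K t ≤ log (1+ρ)` (`ρ > −1`), `c t ≤ (1+ρ) · c 0` provided `c 0 ≥ 0`.
[cite: AdamsBuchholzKoteckyMuller2019, Lemma 7.7 (7.75)] -/
theorem le_one_add_mul_of_abs_deriv_le {c c' : ℝ → ℝ} {K t ρ : ℝ} (ht : 0 ≤ t)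
    (hc : ∀ s ∈ Icc 0 t, HasDerivAt c (c' s) s) (hb : ∀ s ∈ Icc 0 t, |c' s| ≤ K * c s)
    (hρ : -1 < ρ) (hKt : K * t ≤ Real.log (1 + ρ)) (hc0 : 0 ≤ c 0) :
    c t ≤ (1 + ρ) * c 0 := by
  have h := le_exp_mul_of_abs_deriv_le ht hc hb
  have hexp : exp (K * t) ≤ 1 + ρ := by
    have h1 : exp (K * t) ≤ exp (Real.log (1 + ρ)) := exp_le_exp.2 hKt
    rwa [Real.exp_log (by linarith)] at h1
  exact h.trans (mul_le_mul_of_nonneg_right hexp hc0)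

end Literature.MathematicalPhysics.StatisticalMechanics.GradientRG

end
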